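import Summits.QuantumAdvantage.QuantumAdvantage.Theses.ThirdFactorialPincer

/-!
# QuantumAdvantage / ThirdFactorialPincer — `DigitCongruence` (stmt-QuantumAdvantage-11646)

Face (D) of card third-factorial-pincer-v2, PROVED (elementary, finite sums in `ZMod p` and `ℂ`).

Let `p ≡ 1 (mod 3)` be prime, `K = (p − 1)/3`, `r` a root of `r² + r + 1 ≡ 0 (mod p)` (a primitive
cube root of unity mod `p`), and `χ(j) = ω^i ⟺ j^K ≡ r^i (mod p)` the cubic character written out
by cases as in the route file (`ω = exp(2πi/3)`), `S_p = Σ_{1 ≤ j ≤ K} χ(j)`. Then there is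
`t < 3` with `(K!)^K ≡ r^t (mod p)` (i.e. `χ(K!) = ω^t`) and `S_p = K − (1 − ω)·t + 3·(c + dω)`
for some `c, d ∈ ℤ` (i.e. `S_p ≡ K − (1 − ω)t (mod 3ℤ[ω])`).

Proof. For `1 ≤ j ≤ K < p`, `x_j := j^K` satisfies `x_j³ = j^{p−1} = 1` (Fermat), and the cube
roots of unity in `𝔽_p` are `1, r, r²` (`(x−1)(x−r)(x−r²) = x³ − 1` because `r² + r + 1 = 0`).
With `n₁ = #{j : x_j = r}`, `n₂ = #{j : x_j = r²}`, `n₀ = K − n₁ − n₂` and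
`t := (n₁ + 2n₂) mod 3`, `q := ⌊(n₁ + 2n₂)/3⌋`:
`(K!)^K = ∏ x_j = r^{n₁} (r²)^{n₂} = r^{3q + t} = r^t`, and
`S_p = n₀ + n₁ω + n₂ω² = K − (1 − ω)t + 3(−q + (q − n₂)ω)` using `ω² + ω + 1 = 0`.

HONEST FRAMING (block-2b rule): the value here is a closed ledger item (an elementary theorem,
kernel-checked), not summit progress.

References: K. Ireland, M. Rosen, *A Classical Introduction to Modern Number Theory*, GTM 84
(1990), Ch. 9 §§3–4 (cubic characters, primary elements; the expansion `ω ≡ 1 − λ (mod λ²)`,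
`λ = 1 − ω`, `(3) = (λ)²`). [IrelandRosen1990]
-/

set_option linter.dupNamespace false -- D-0017: single-problem summit ⇒ `QuantumAdvantage.QuantumAdvantage` by design

namespace Summit.QuantumAdvantage.QuantumAdvantage.Theorems.DigitCongruence

open Finset

/-! ### Cube roots of unity in `ZMod p` -/

/-- If `r² + r + 1 = 0` then `r³ = 1` (in any commutative ring). [folklore] -/
theorem pow_three_eq_one_of_root {R : Type*} [CommRing R] {r : R} (hr : r * r + r + 1 = 0) :
    r ^ 3 = 1 := by
  have h : r ^ 3 - 1 = (r - 1) * (r * r + r + 1) := by ring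
  rw [← sub_eq_zero, h, hr, mul_zero]

/-- In a field, if `r² + r + 1 = 0` then every cube root of unity is `1`, `r` or `r²`
(`(x − 1)(x − r)(x − r²) = x³ − 1`). [folklore] -/
theorem eq_one_or_eq_or_eq_sq {F : Type*} [Field F] {r x : F} (hr : r * r + r + 1 = 0)
    (hx : x ^ 3 = 1) : x = 1 ∨ x = r ∨ x = r ^ 2 := by
  have hr3 : r ^ 3 = 1 := pow_three_eq_one_of_root hr
  have hfac : (x - 1) * (x - r) * (x - r ^ 2) = 0 := by
    have h : (x - 1) * (x - r) * (x - r ^ 2) =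
        x ^ 3 - 1 - (r * r + r + 1) * x ^ 2 + (r * r + r + 1) * r * x + (1 - r ^ 3) := by ring
    rw [h, hr, hr3, hx]
    ring
  rcases mul_eq_zero.1 hfac with h | h
  · rcases mul_eq_zero.1 h with h | h
    · exact Or.inl (sub_eq_zero.1 h)
    · exact Or.inr (Or.inl (sub_eq_zero.1 h))
  · exact Or.inr (Or.inr (sub_eq_zero.1 h))

/-- A root of `r² + r + 1` in a field of characteristic `≠ 3` is not `1`. Here: in `ZMod p` with
`p` prime and `p % 3 = 1`. [folklore] -/
theorem root_ne_one {p : ℕ} [Fact p.Prime] (hp3 : p % 3 = 1) {r : ZMod p}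
    (hr : r * r + r + 1 = 0) : r ≠ 1 := by
  rintro rfl
  have h3 : ((3 : ℕ) : ZMod p) = 0 := by
    have : (1 : ZMod p) * 1 + 1 + 1 = 3 := by norm_num
    rw [this] at hr
    exact_mod_cast hr
  rw [ZMod.natCast_eq_zero_iff] at h3
  have := (Nat.prime_dvd_prime_iff_eq (Fact.out : p.Prime) Nat.prime_three).1 h3
  omega

/-- … and its square is neither `1` nor `r`. [folklore] -/
theorem root_sq_ne {p : ℕ} [Fact p.Prime] (hp3 : p % 3 = 1) {r : ZMod p}
    (hr : r * r + r + 1 = 0) : r ^ 2 ≠ 1 ∧ r ^ 2 ≠ r := by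
  have hr1 : r ≠ 1 := root_ne_one hp3 hr
  have hr3 : r ^ 3 = 1 := pow_three_eq_one_of_root hr
  have hr0 : r ≠ 0 := by
    rintro rfl
    simp at hr
  constructor
  · intro h
    -- r = r³ / r² = 1
    apply hr1
    have : r = r ^ 3 * (r ^ 2)⁻¹ := by field_simp
    rw [this, hr3, h, inv_one, one_mul]
  · intro h
    apply hr1
    have : r = r ^ 2 * r⁻¹ := by field_simp
    rw [this, h, mul_inv_cancel₀ hr0]

/-! ### The theorem -/

/-- **`DigitCongruence`** (stmt-QuantumAdvantage-11646; card third-factorial-pincer-v2, face (D)):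
for `p ≡ 1 (3)` prime, `K = (p−1)/3`, `r` a primitive cube root of unity mod `p` and the cubic
character `χ(j) = ω^i ⟺ j^K ≡ r^i`, there is `t < 3` with `(K!)^K ≡ r^t (mod p)` and
`S_p = Σ_{j ≤ K} χ(j) = K − (1 − ω)t + 3(c + dω)` for some integers `c, d`.
[Ireland–Rosen 1990, Ch. 9 §§3–4] [folklore] -/
theorem digitCongruence_proof :
    Summit.QuantumAdvantage.QuantumAdvantage.Theses.ThirdFactorialPincer.DigitCongruence := by
  unfold Summit.QuantumAdvantage.QuantumAdvantage.Theses.ThirdFactorialPincer.DigitCongruence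
  intro p r hp hp3 hrp hr _h2r
  haveI : Fact p.Prime := ⟨hp⟩
  -- notation
  set K : ℕ := (p - 1) / 3 with hK
  set ω : ℂ := Complex.exp (2 * Real.pi * Complex.I / 3) with hω
  set s : Finset ℕ := Finset.Icc 1 K with hs
  -- facts about `r` in `ZMod p`
  have hr0 : (r : ZMod p) * r + r + 1 = 0 := by
    have h := (ZMod.natCast_eq_zero_iff (r * r + r + 1) p).2 (Nat.dvd_of_mod_eq_zero hr)
    push_cast at h
    exact h
  have hr3 : (r : ZMod p) ^ 3 = 1 := pow_three_eq_one_of_root hr0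
  have hr1 : (r : ZMod p) ≠ 1 := root_ne_one hp3 hr0
  obtain ⟨hr21, hr2r⟩ := root_sq_ne hp3 hr0
  have h3K : K * 3 = p - 1 := by omega
  -- every `j^K`, `1 ≤ j ≤ K`, is a cube root of unity, hence `1`, `r` or `r²`
  have htri : ∀ j ∈ s, (j : ZMod p) ^ K = 1 ∨ (j : ZMod p) ^ K = r ∨
      (j : ZMod p) ^ K = (r : ZMod p) ^ 2 := by
    intro j hj
    rw [hs, Finset.mem_Icc] at hj
    have hjp : 1 < p := hp.one_lt
    have hj0 : (j : ZMod p) ≠ 0 := by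
      rw [Ne, ZMod.natCast_eq_zero_iff]
      exact Nat.not_dvd_of_pos_of_lt (by omega) (by omega)
    apply eq_one_or_eq_or_eq_sq hr0
    rw [← pow_mul, h3K]
    exact ZMod.pow_card_sub_one_eq_one hj0
  have hpt : ∀ j ∈ s, (j : ZMod p) ^ K =
      if (j : ZMod p) ^ K = 1 then 1 else if (j : ZMod p) ^ K = r then (r : ZMod p)
        else (r : ZMod p) ^ 2 := by
    intro j hj
    rcases htri j hj with h | h | h
    · rw [if_pos h, h]
    · rw [h, if_neg hr1, if_pos rfl]
    · rw [h, if_neg hr21, if_neg hr2r]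
  -- the three classes
  set B : Finset ℕ := (s.filter fun j : ℕ => ¬ (j : ZMod p) ^ K = 1).filter
    fun j : ℕ => (j : ZMod p) ^ K = r with hB
  set C : Finset ℕ := (s.filter fun j : ℕ => ¬ (j : ZMod p) ^ K = 1).filter
    fun j : ℕ => ¬ (j : ZMod p) ^ K = r with hC
  set A : Finset ℕ := s.filter fun j : ℕ => (j : ZMod p) ^ K = 1 with hA
  have hcard : A.card + (B.card + C.card) = K := by
    rw [hB, hC, Finset.card_filter_add_card_filter_not, hA,
      Finset.card_filter_add_card_filter_not, hs, Nat.card_Icc]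
    omega
  set q : ℕ := (B.card + 2 * C.card) / 3 with hq
  set t : ℕ := (B.card + 2 * C.card) % 3 with ht
  have hqt : 3 * q + t = B.card + 2 * C.card := Nat.div_add_mod _ 3
  refine ⟨t, Nat.mod_lt _ (by norm_num), ?_, -(q : ℤ), (q : ℤ) - C.card, ?_⟩
  · -- `(K!)^K = r^t`
    have hfact : ((Nat.factorial K : ℕ) : ZMod p) = ∏ j ∈ s, (j : ZMod p) := by
      rw [hs, ← Finset.Ico_add_one_right_eq_Icc, ← Finset.prod_Ico_id_eq_factorial, Nat.cast_prod]
    rw [hfact, ← Finset.prod_pow, Finset.prod_congr rfl hpt, Finset.prod_ite, Finset.prod_ite, Finset.prod_const_one, one_mul, Finset.prod_const,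
      Finset.prod_const, ← hB, ← hC, ← pow_mul, ← pow_add, ← hqt, pow_add, pow_mul, hr3, one_pow,
      one_mul]
  · -- the sum
    have hω3 : IsPrimitiveRoot ω 3 := by
      have h := Complex.isPrimitiveRoot_exp 3 (by norm_num)
      norm_num at h
      exact h
    have hω2 : ω ^ 2 + ω + 1 = 0 := by
      have h := hω3.geom_sum_eq_zero (by norm_num : 1 < 3)
      simp only [Finset.sum_range_succ, Finset.sum_range_zero, pow_zero, pow_one, zero_add] at h
      linear_combination h
    have hK' : (K : ℂ) = A.card + B.card + C.card := by
      rw [← hcard]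
      push_cast
      ring
    have ht' : ((t : ℕ) : ℂ) = B.card + 2 * C.card - 3 * q := by
      have h : ((3 * q + t : ℕ) : ℂ) = ((B.card + 2 * C.card : ℕ) : ℂ) := by rw [hqt]
      push_cast at h
      linear_combination h
    rw [Finset.sum_ite, Finset.sum_ite]
    simp only [Finset.sum_const, nsmul_eq_mul, mul_one]
    rw [← hA, ← hB, ← hC]
    push_cast
    linear_combination (-1 : ℂ) * hK' + (1 - ω) * ht' + (C.card : ℂ) * hω2

end Summit.QuantumAdvantage.QuantumAdvantage.Theorems.DigitCongruence
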